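import Summits.CriticalPhenomena.PercolationContinuityZ3.Theorems.PercNearOneGluingNoHeavyLowerTailMajorityGluingTypeTableCertificates
import HarnessLib

/-!
# The star certificates STAR_w and R207 of the abstract `(4,3)` programme at the level of laws
(lane prim-rate, constants-miner 1, gen 27; CLEAN-CERTIFICATES.md §1, §2, §8)

Support file for the closed crux `NoHeavyLowerTail` (stmt-CriticalPhenomena-4575), majority-gluing line; continuation
of `…MajorityGluingTypeTableCertificates` (same conventions: a LAW is `x : DType → ℝ`, `x ≥ 0`; rows are hypotheses).

* STAR₁..₄ (gen 24, CLEAN-CERTIFICATES §8), linear form: `3E ≤ u₁₂₃₄ + Σ_{g∋w} (x(P_g) − 2x(C_g))`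
  (`= ⅓`-normalised: `E ≤ ⅓u₁₂₃₄ + Σ_{g∋w}[⅓a′_g − x(C_g)]`, `a′_g = x(C_g) + x(P_g)`);
* the θ-FORM used by THEOREM BOTTOM for the dominant relay `w`: if `S_w ≤ (2−θ)T_w` (`r_w ≤ 1−θ`), then with the
  three hub-pair rows `T_wT_z ≤ x(C_{wz})x(all cut)` and the three relay-root rows rooted at `v_w` in reduced form
  `(x(C_{wz}) + x(P_{wz}))·T_w ≤ x(C_{wz})·(T_w + S_w)`:  `x(all cut)·3E ≤ x(all cut)·u₁₂₃₄ − θ·T_w·Σ_{z≠w}T_z`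
  — the richness of the other three relays is irrelevant (`pair_step`, `star_theta_real` are the real-arithmetic core);
* R207 (gens 22/23), linear form: `4E ≤ u₁₂₃₄ + Σ_g (x(P_g) − 2x(C_g))` over all six pairs — the linear core of
  THEOREM S2-OPT (§2).

Linear/bilinear real arithmetic over the kernel-checked table facts; no definitions, no sorries.
[cite: VandenbergHaggstromKahn2005, Thm. 1.3 (p. 6)]
-/

namespace Summit.CriticalPhenomena.PercolationContinuityZ3.Theorems

namespace HubOnly
namespace TypeTable

noncomputable section
open DType

/-! ### The star certificates STAR_w (gen 24, CLEAN-CERTIFICATES §8) and R207 -/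

/-- **STAR₁, linear form** (rows `B₂`, `O_dn4_23`, `O_up4_23`, `O_dn3_24`):
`3E ≤ u₁₂₃₄ + Σ_{z=2,3,4} (x(P₁z) − 2·x(C₁z))` (`= u₁₂₃₄ + Σ_{g∋1}[a′_g − 3x(C_g)]`, `a′_g = x(C_g) + x(P_g)`). -/
theorem star1 (x : DType → ℝ) (hx : ∀ τ, 0 ≤ x τ) (r1 : lin (fun τ => τ.bud 2) x ≤ 0)
    (r2 : lin (fun τ => τ.odn 4 2 3) x ≤ 0) (r3 : lin (fun τ => τ.oup 4 2 3) x ≤ 0)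
    (r4 : lin (fun τ => τ.odn 3 2 4) x ≤ 0) :
    3 * E x ≤ uS [1, 2, 3, 4] x + ((Pm 1 2 x - 2 * Cm 1 2 x) + (Pm 1 3 x - 2 * Cm 1 3 x)
      + (Pm 1 4 x - 2 * Cm 1 4 x)) := by
  have h := cc_bound _ x rc_STAR1.1 hx
  simp only [List.map_cons, List.map_nil, List.sum_cons, List.sum_nil] at h
  push_cast at h
  simp only [E, uS, Cm, Pm]
  linarith

/-- **STAR₂, linear form** (rows `Cpair_34`, `CaloneY_3_2`, `CaloneY_4_2`). -/
theorem star2 (x : DType → ℝ) (hx : ∀ τ, 0 ≤ x τ) (r1 : lin (fun τ => τ.cpair 3 4) x ≤ 0)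
    (r2 : lin (fun τ => τ.caloneY 3 2) x ≤ 0) (r3 : lin (fun τ => τ.caloneY 4 2) x ≤ 0) :
    3 * E x ≤ uS [1, 2, 3, 4] x + ((Pm 2 1 x - 2 * Cm 2 1 x) + (Pm 2 3 x - 2 * Cm 2 3 x)
      + (Pm 2 4 x - 2 * Cm 2 4 x)) := by
  have h := cc_bound _ x rc_STAR2 hx
  simp only [List.map_cons, List.map_nil, List.sum_cons, List.sum_nil] at h
  push_cast at h
  simp only [E, uS, Cm, Pm]
  linarith

/-- **STAR₃, linear form** (rows `Cpair_24`, `CaloneY_2_3`, `CaloneY_4_3`). -/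
theorem star3 (x : DType → ℝ) (hx : ∀ τ, 0 ≤ x τ) (r1 : lin (fun τ => τ.cpair 2 4) x ≤ 0)
    (r2 : lin (fun τ => τ.caloneY 2 3) x ≤ 0) (r3 : lin (fun τ => τ.caloneY 4 3) x ≤ 0) :
    3 * E x ≤ uS [1, 2, 3, 4] x + ((Pm 3 1 x - 2 * Cm 3 1 x) + (Pm 3 2 x - 2 * Cm 3 2 x)
      + (Pm 3 4 x - 2 * Cm 3 4 x)) := by
  have h := cc_bound _ x rc_STAR3 hx
  simp only [List.map_cons, List.map_nil, List.sum_cons, List.sum_nil] at h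
  push_cast at h
  simp only [E, uS, Cm, Pm]
  linarith

/-- **STAR₄, linear form** (rows `Cpair_23`, `CaloneY_2_4`, `CaloneY_3_4`). -/
theorem star4 (x : DType → ℝ) (hx : ∀ τ, 0 ≤ x τ) (r1 : lin (fun τ => τ.cpair 2 3) x ≤ 0)
    (r2 : lin (fun τ => τ.caloneY 2 4) x ≤ 0) (r3 : lin (fun τ => τ.caloneY 3 4) x ≤ 0) :
    3 * E x ≤ uS [1, 2, 3, 4] x + ((Pm 4 1 x - 2 * Cm 4 1 x) + (Pm 4 2 x - 2 * Cm 4 2 x)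
      + (Pm 4 3 x - 2 * Cm 4 3 x)) := by
  have h := cc_bound _ x rc_STAR4 hx
  simp only [List.map_cons, List.map_nil, List.sum_cons, List.sum_nil] at h
  push_cast at h
  simp only [E, uS, Cm, Pm]
  linarith

/-- **R207, linear form** (rows `Ctriple`, `Cnotfull₂,₃,₄`): `4E ≤ u₁₂₃₄ + Σ_g (x(P_g) − 2·x(C_g))` over all six
pairs — the linear core of THEOREM S2-OPT (CLEAN-CERTIFICATES §2). -/
theorem r207 (x : DType → ℝ) (hx : ∀ τ, 0 ≤ x τ) (r1 : lin ctriple x ≤ 0)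
    (r2 : lin (fun τ => τ.cnotfull 2) x ≤ 0) (r3 : lin (fun τ => τ.cnotfull 3) x ≤ 0)
    (r4 : lin (fun τ => τ.cnotfull 4) x ≤ 0) :
    4 * E x ≤ uS [1, 2, 3, 4] x + ((Pm 1 2 x - 2 * Cm 1 2 x) + (Pm 1 3 x - 2 * Cm 1 3 x)
      + (Pm 1 4 x - 2 * Cm 1 4 x) + (Pm 2 3 x - 2 * Cm 2 3 x) + (Pm 2 4 x - 2 * Cm 2 4 x)
      + (Pm 3 4 x - 2 * Cm 3 4 x)) := by
  have h := cc_bound _ x rc_R207.1 hx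
  simp only [List.map_cons, List.map_nil, List.sum_cons, List.sum_nil] at h
  push_cast at h
  simp only [E, uS, Cm, Pm]
  linarith

/-- The per-pair step of the θ-form (pure real arithmetic): the relay-root row in reduced form and the richness
bound `S ≤ (2−θ)T` of the root give `x(C_g) + x(P_g) ≤ (3−θ)·x(C_g)`; the hub row turns `−θ·x(C_g)·x(all cut)`
into `−θ·T_wT_z`. -/
theorem pair_step {θ T Tz S C P AC : ℝ} (hθ : 0 ≤ θ) (hT : 0 < T) (hC : 0 ≤ C) (hAC : 0 ≤ AC)
    (hrich : S ≤ (2 - θ) * T) (hub : T * Tz ≤ C * AC) (rel : (C + P) * T ≤ C * (T + S)) :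
    AC * (P - 2 * C) ≤ -(θ * (T * Tz)) := by
  have h1 : (C + P) * T ≤ C * ((3 - θ) * T) := rel.trans (by nlinarith)
  have h2 : C + P ≤ (3 - θ) * C := by nlinarith
  nlinarith

/-- The θ-form assembled (pure real arithmetic): a linear star bound `3E ≤ U + Σ_i (P_i − 2C_i)`, the three pair steps. -/
theorem star_theta_real {θ Ex U AC T S T1 T2 T3 C1 C2 C3 P1 P2 P3 : ℝ} (hθ : 0 ≤ θ) (hT : 0 < T)
    (hAC : 0 ≤ AC) (hC1 : 0 ≤ C1) (hC2 : 0 ≤ C2) (hC3 : 0 ≤ C3) (hrich : S ≤ (2 - θ) * T)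
    (hlin : 3 * Ex ≤ U + ((P1 - 2 * C1) + (P2 - 2 * C2) + (P3 - 2 * C3)))
    (hub1 : T * T1 ≤ C1 * AC) (hub2 : T * T2 ≤ C2 * AC) (hub3 : T * T3 ≤ C3 * AC)
    (rel1 : (C1 + P1) * T ≤ C1 * (T + S)) (rel2 : (C2 + P2) * T ≤ C2 * (T + S))
    (rel3 : (C3 + P3) * T ≤ C3 * (T + S)) :
    AC * (3 * Ex) ≤ AC * U - θ * (T * (T1 + T2 + T3)) := by
  have h0 := mul_le_mul_of_nonneg_left hlin hAC
  have p1 := pair_step hθ hT hC1 hAC hrich hub1 rel1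
  have p2 := pair_step hθ hT hC2 hAC hrich hub2 rel2
  have p3 := pair_step hθ hT hC3 hAC hrich hub3 rel3
  nlinarith

/-- **STAR₁, θ-form** (CLEAN-CERTIFICATES §8, the form THEOREM BOTTOM uses for the dominant relay): if relay 1 is not
rich, `S₁ ≤ (2 − θ)T₁` (`r₁ ≤ 1 − θ`, `θ ≥ 0`, `T₁ > 0`), then with its four linear rows, the three hub-pair rows
`T₁T_z ≤ x(C₁z)x(all cut)` and the three relay-root rows rooted at `v₁` in reduced form
`(x(C₁z) + x(P₁z))·T₁ ≤ x(C₁z)·(T₁ + S₁)` (see `relay_row_reduced`):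
`x(all cut)·3E ≤ x(all cut)·u₁₂₃₄ − θ·T₁·(T₂ + T₃ + T₄)` — the richness of the other three relays is irrelevant. -/
theorem star1_theta (x : DType → ℝ) (hx : ∀ τ, 0 ≤ x τ) {θ : ℝ} (hθ : 0 ≤ θ) (hT : 0 < Tm 1 x)
    (hrich : Sm 1 x ≤ (2 - θ) * Tm 1 x)
    (r1 : lin (fun τ => τ.bud 2) x ≤ 0) (r2 : lin (fun τ => τ.odn 4 2 3) x ≤ 0)
    (r3 : lin (fun τ => τ.oup 4 2 3) x ≤ 0) (r4 : lin (fun τ => τ.odn 3 2 4) x ≤ 0)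
    (hub2 : Tm 1 x * Tm 2 x ≤ Cm 1 2 x * ACm x) (hub3 : Tm 1 x * Tm 3 x ≤ Cm 1 3 x * ACm x)
    (hub4 : Tm 1 x * Tm 4 x ≤ Cm 1 4 x * ACm x)
    (rel2 : (Cm 1 2 x + Pm 1 2 x) * Tm 1 x ≤ Cm 1 2 x * (Tm 1 x + Sm 1 x))
    (rel3 : (Cm 1 3 x + Pm 1 3 x) * Tm 1 x ≤ Cm 1 3 x * (Tm 1 x + Sm 1 x))
    (rel4 : (Cm 1 4 x + Pm 1 4 x) * Tm 1 x ≤ Cm 1 4 x * (Tm 1 x + Sm 1 x)) :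
    ACm x * (3 * E x) ≤ ACm x * uS [1, 2, 3, 4] x - θ * (Tm 1 x * (Tm 2 x + Tm 3 x + Tm 4 x)) :=
  star_theta_real hθ hT (lin_ind_nonneg _ hx) (lin_ind_nonneg _ hx) (lin_ind_nonneg _ hx) (lin_ind_nonneg _ hx)
    hrich (star1 x hx r1 r2 r3 r4) hub2 hub3 hub4 rel2 rel3 rel4

/-- **STAR₂, θ-form**: `x(all cut)·3E ≤ x(all cut)·u₁₂₃₄ − θ·T₂·(T₁ + T₃ + T₄)` under `S₂ ≤ (2−θ)T₂`, `T₂ > 0`. -/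
theorem star2_theta (x : DType → ℝ) (hx : ∀ τ, 0 ≤ x τ) {θ : ℝ} (hθ : 0 ≤ θ) (hT : 0 < Tm 2 x)
    (hrich : Sm 2 x ≤ (2 - θ) * Tm 2 x)
    (r1 : lin (fun τ => τ.cpair 3 4) x ≤ 0) (r2 : lin (fun τ => τ.caloneY 3 2) x ≤ 0)
    (r3 : lin (fun τ => τ.caloneY 4 2) x ≤ 0)
    (hub1 : Tm 2 x * Tm 1 x ≤ Cm 2 1 x * ACm x) (hub3 : Tm 2 x * Tm 3 x ≤ Cm 2 3 x * ACm x)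
    (hub4 : Tm 2 x * Tm 4 x ≤ Cm 2 4 x * ACm x)
    (rel1 : (Cm 2 1 x + Pm 2 1 x) * Tm 2 x ≤ Cm 2 1 x * (Tm 2 x + Sm 2 x))
    (rel3 : (Cm 2 3 x + Pm 2 3 x) * Tm 2 x ≤ Cm 2 3 x * (Tm 2 x + Sm 2 x))
    (rel4 : (Cm 2 4 x + Pm 2 4 x) * Tm 2 x ≤ Cm 2 4 x * (Tm 2 x + Sm 2 x)) :
    ACm x * (3 * E x) ≤ ACm x * uS [1, 2, 3, 4] x - θ * (Tm 2 x * (Tm 1 x + Tm 3 x + Tm 4 x)) :=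
  star_theta_real hθ hT (lin_ind_nonneg _ hx) (lin_ind_nonneg _ hx) (lin_ind_nonneg _ hx) (lin_ind_nonneg _ hx)
    hrich (star2 x hx r1 r2 r3) hub1 hub3 hub4 rel1 rel3 rel4

/-- **STAR₃, θ-form**: `x(all cut)·3E ≤ x(all cut)·u₁₂₃₄ − θ·T₃·(T₁ + T₂ + T₄)` under `S₃ ≤ (2−θ)T₃`, `T₃ > 0`. -/
theorem star3_theta (x : DType → ℝ) (hx : ∀ τ, 0 ≤ x τ) {θ : ℝ} (hθ : 0 ≤ θ) (hT : 0 < Tm 3 x)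
    (hrich : Sm 3 x ≤ (2 - θ) * Tm 3 x)
    (r1 : lin (fun τ => τ.cpair 2 4) x ≤ 0) (r2 : lin (fun τ => τ.caloneY 2 3) x ≤ 0)
    (r3 : lin (fun τ => τ.caloneY 4 3) x ≤ 0)
    (hub1 : Tm 3 x * Tm 1 x ≤ Cm 3 1 x * ACm x) (hub2 : Tm 3 x * Tm 2 x ≤ Cm 3 2 x * ACm x)
    (hub4 : Tm 3 x * Tm 4 x ≤ Cm 3 4 x * ACm x)
    (rel1 : (Cm 3 1 x + Pm 3 1 x) * Tm 3 x ≤ Cm 3 1 x * (Tm 3 x + Sm 3 x))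
    (rel2 : (Cm 3 2 x + Pm 3 2 x) * Tm 3 x ≤ Cm 3 2 x * (Tm 3 x + Sm 3 x))
    (rel4 : (Cm 3 4 x + Pm 3 4 x) * Tm 3 x ≤ Cm 3 4 x * (Tm 3 x + Sm 3 x)) :
    ACm x * (3 * E x) ≤ ACm x * uS [1, 2, 3, 4] x - θ * (Tm 3 x * (Tm 1 x + Tm 2 x + Tm 4 x)) :=
  star_theta_real hθ hT (lin_ind_nonneg _ hx) (lin_ind_nonneg _ hx) (lin_ind_nonneg _ hx) (lin_ind_nonneg _ hx)
    hrich (star3 x hx r1 r2 r3) hub1 hub2 hub4 rel1 rel2 rel4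

/-- **STAR₄, θ-form**: `x(all cut)·3E ≤ x(all cut)·u₁₂₃₄ − θ·T₄·(T₁ + T₂ + T₃)` under `S₄ ≤ (2−θ)T₄`, `T₄ > 0`. -/
theorem star4_theta (x : DType → ℝ) (hx : ∀ τ, 0 ≤ x τ) {θ : ℝ} (hθ : 0 ≤ θ) (hT : 0 < Tm 4 x)
    (hrich : Sm 4 x ≤ (2 - θ) * Tm 4 x)
    (r1 : lin (fun τ => τ.cpair 2 3) x ≤ 0) (r2 : lin (fun τ => τ.caloneY 2 4) x ≤ 0)
    (r3 : lin (fun τ => τ.caloneY 3 4) x ≤ 0)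
    (hub1 : Tm 4 x * Tm 1 x ≤ Cm 4 1 x * ACm x) (hub2 : Tm 4 x * Tm 2 x ≤ Cm 4 2 x * ACm x)
    (hub3 : Tm 4 x * Tm 3 x ≤ Cm 4 3 x * ACm x)
    (rel1 : (Cm 4 1 x + Pm 4 1 x) * Tm 4 x ≤ Cm 4 1 x * (Tm 4 x + Sm 4 x))
    (rel2 : (Cm 4 2 x + Pm 4 2 x) * Tm 4 x ≤ Cm 4 2 x * (Tm 4 x + Sm 4 x))
    (rel3 : (Cm 4 3 x + Pm 4 3 x) * Tm 4 x ≤ Cm 4 3 x * (Tm 4 x + Sm 4 x)) :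
    ACm x * (3 * E x) ≤ ACm x * uS [1, 2, 3, 4] x - θ * (Tm 4 x * (Tm 1 x + Tm 2 x + Tm 3 x)) :=
  star_theta_real hθ hT (lin_ind_nonneg _ hx) (lin_ind_nonneg _ hx) (lin_ind_nonneg _ hx) (lin_ind_nonneg _ hx)
    hrich (star4 x hx r1 r2 r3) hub1 hub2 hub3 rel1 rel2 rel3

end

end TypeTable
end HubOnly

end Summit.CriticalPhenomena.PercolationContinuityZ3.Theorems
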